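import Summits.BirchSwinnertonDyer.BirchSwinnertonDyer.Theorems.Rank2Observatory2DescClCurveCertE3N
import Summits.BirchSwinnertonDyer.BirchSwinnertonDyer.Theorems.Rank2Observatory2DescClCurveCertSX
import HarnessLib

/-!
# BirchSwinnertonDyer — rank ≥ 2 observatory: KERNEL-2DESC-CL v3.0 — NODAL LOCAL CONDITIONS on the SPLIT-2 host, complex case (`…SN`)

HONEST FRAMING: per-curve certified theorems and census instruments; no claim on BSD in rank ≥ 2.

The consumer of `…ClCurveCertSX` (`checkSCore` + `rank_le_of_checkSX`): the per-curve checker **`checkSN`** =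
the core clauses of the landed split-2 checker `checkS` (fields with `2` totally split and no second order `ℤ[η]`,
complex cubic) ∧ the NODAL kernel clauses of `…ClCurveCertE3N` (records `NodalCert`, Hensel certificates
`henselAll`, read here on the one-view fractional coordinates `X_t`, `X_j` of the split-2 record: `nodRootsS`,
`nodTableS`, `nodalClauseOddS`, `nodalClauseTwoS`) ∧ the survivor count of `admS ∧ extraNS` `≤ 2 ^ r`, where
`extraNS U` = «the kernel class vector of `U` lies in the enumerated exact local image `splitImgOdd ℓ` /
`splitImgTwo` at every listed nodal prime».  Soundness **`rank_le_of_checkSN`** = `rank_le_of_checkSX` with the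
pointwise soundness of `extraNS` discharged by the landed per-point nodal lemmas `uvecOdd_mem_splitImgOdd` /
`uvecTwo_mem_splitImgTwo` (`…SplitImageNodal{,Two}`) exactly as in the landed `…ClCurveCertE3N` / `…ClCurveCertE2RN`
(scaling `m = r₁²`).  Row wrappers `rank_eq_of_certsSN{,_scaled,_complSq,_plain}`.  In these fields `2` is totally
split, so the `2`-ADIC certificates (`nod2`) are the typical consumer.  New declarations only.
Sorry-free; axioms `propext`, `Classical.choice`, `Quot.sound`.
[cite: Cassels1991LecturesEllipticCurves, §15] [cite: CremonaAlgorithms1997, §3.6] [cite: SilvermanAEC2009, VII.2.2, X.1.1]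
[cite: Cohen1993, §6.5]
-/

set_option linter.dupNamespace false
set_option autoImplicit false

noncomputable section

open scoped Classical NumberField nonZeroDivisors

open Literature.NumberTheory.NumberFields Polynomial Module NumberField IsDedekindDomain Ideal

namespace Summit.BirchSwinnertonDyer.BirchSwinnertonDyer.Rank2Observatory.TwoDescCl

open TwoDescCubic ClFieldCert SplitImage TwoDescPadic

/-! ## Records -/

/-- **Per-curve record with nodal local conditions (split-2 host, complex case)**: the split-2 record of
`…ClCurveCertSDefs`, the odd nodal primes and the `2`-adic nodal certificates (field `ℓ` must be `2` there).
[cite: Cassels1991LecturesEllipticCurves, §15] -/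
structure ClCurveCertSN where
  /-- the split-2 per-curve record (complex case) -/
  cr : ClCurveCertS
  /-- odd nodal primes -/
  nod : List NodalCert
  /-- `2`-adic nodal certificates -/
  nod2 : List NodalCert

/-! ## Kernel clauses (computable) -/

section Kernel

/-- The integer stand-ins `X_t(a_i)` of the scaled roots `m₁ e_i`. [folklore] -/
def nodRootsS (cc : ClCurveCertS) (n : NodalCert) : Fin 3 → ℤ := fun i => evalInt (n.ar i) cc.Xt

/-- The integer table `X_j(a_i)` of the scaled family `m₁ w_j` at the three roots. [folklore] -/
def nodTableS (cc : ClCurveCertS) (n : NodalCert) : Fin 3 → Fin (famS cc).length → ℤ :=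
  fun i j => evalInt (n.ar i) ((famS cc).get j).X

/-- **Kernel clause of an odd nodal prime**: `ℓ ≠ 2`, three Hensel certificates, `X_t(a_i)` pairwise distinct,
tree precision `nodeDepth + 1 ≤ N`, table entries non-zero of valuation `< N`. [folklore] -/
def nodalClauseOddS (fc : ClFieldCert) (cc : ClCurveCertS) (n : NodalCert) : Bool :=
  !decide (n.ℓ = 2) && henselAll fc n &&
    decide (∀ i k : Fin 3, i ≠ k → nodRootsS cc n i ≠ nodRootsS cc n k) &&
    decide (nodeDepth n.ℓ (nodRootsS cc n) + 1 ≤ n.N) &&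
    decide (∀ i : Fin 3, ∀ j : Fin (famS cc).length, nodTableS cc n i j ≠ 0 ∧ valInt n.ℓ (nodTableS cc n i j) < n.N)

/-- **Kernel clause of a `2`-adic nodal certificate**: `ℓ = 2`, three Hensel certificates, `X_t(a_i)` pairwise
distinct, tree precision `nodeDepth + 4 ≤ N`, table entries non-zero with `v_2 + 3 ≤ N`. [folklore] -/
def nodalClauseTwoS (fc : ClFieldCert) (cc : ClCurveCertS) (n : NodalCert) : Bool :=
  decide (n.ℓ = 2) && henselAll fc n &&
    decide (∀ i k : Fin 3, i ≠ k → nodRootsS cc n i ≠ nodRootsS cc n k) &&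
    decide (nodeDepth 2 (nodRootsS cc n) + 4 ≤ n.N) &&
    decide (∀ i : Fin 3, ∀ j : Fin (famS cc).length, nodTableS cc n i j ≠ 0 ∧ valInt 2 (nodTableS cc n i j) + 3 ≤ n.N)

/-- **The nodal sieve conjunct**: the kernel class vector of `U` lies in the enumerated local image at every listed
prime. [cite: Cassels1991LecturesEllipticCurves, §15] -/
def extraNS (c : ClCurveCertSN) (U : Finset (Fin (famS c.cr).length)) : Bool :=
  (c.nod.all fun n => decide (uvecOdd n.ℓ (nodTableS c.cr n) U ∈ splitImgOdd n.ℓ (nodRootsS c.cr n))) &&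
    (c.nod2.all fun n => decide (uvecTwo (nodTableS c.cr n) U ∈ splitImgTwo (nodRootsS c.cr n)))

variable (F : ClFieldCertS2) (c : ClCurveCertSN)

/-- **The split-2 per-curve checker (complex case) with nodal local conditions for `rank ≤ r`**: the core
clauses of `checkS`, the nodal kernel clauses, and the count of survivors of `admS ∧ extraNS` `≤ 2 ^ r`. Computable; run
by `decide +kernel`. [cite: Cassels1991LecturesEllipticCurves, §15] -/
def checkSN (r : ℕ) : Bool :=
  checkSCore F c.cr && (c.nod.all fun n => nodalClauseOddS F.fs.base c.cr n) &&
    (c.nod2.all fun n => nodalClauseTwoS F.fs.base c.cr n) &&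
    decide (((Finset.univ ×ˢ Finset.univ).filter
      (fun p : Finset (Fin 0) × Finset (Fin (famS c.cr).length) =>
        (admS F c.cr p.1 p.2 && extraNS c p.2) = true)).card ≤ 2 ^ r)

end Kernel

/-! ## Soundness -/

section Sound

variable {K : Type*} [Field K] [NumberField K] {θ : K}

/-- **Soundness of the split-2 checker (complex case) with nodal local conditions: `rank E(ℚ) ≤ r`.**
[cite: Cassels1991LecturesEllipticCurves, §15] [cite: CremonaAlgorithms1997, §3.6] -/
theorem rank_le_of_checkSN (r : ℕ) (F : ClFieldCertS2)
    (hθ : aeval θ (MonicCubic.poly F.fs.base.a F.fs.base.b F.fs.base.c) = 0) (h3 : finrank ℚ K = 3)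
    (h2 : F.check2 = true) (hpr : F.fs.base.primeList.Forall Nat.Prime)
    (c : ClCurveCertSN) (hnp : (c.nod.map NodalCert.ℓ).Forall Nat.Prime) (hc : checkSN F c r = true) :
    ((⟨0, c.cr.A, 0, c.cr.B, c.cr.C⟩ : WeierstrassCurve ℚ)).mordellWeilRank ≤ r := by
  classical
  unfold checkSN at hc
  have hcount := of_decide_eq_true (Bool.and_eq_true_iff.mp hc).2
  have h123 := (Bool.and_eq_true_iff.mp hc).1
  have hnod2 := List.all_eq_true.mp (Bool.and_eq_true_iff.mp h123).2
  have hnod := List.all_eq_true.mp (Bool.and_eq_true_iff.mp (Bool.and_eq_true_iff.mp h123).1).2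
  have hcore := (Bool.and_eq_true_iff.mp (Bool.and_eq_true_iff.mp h123).1).1
  have hK := F.const_of_check2 h2
  have hS := F.coreS_of_check2 h2
  have hR := F.fs.checkReg_of_coreS hS
  have hirr := F.fs.base.irreducible_of_reg hR
  have hm : (F.r₁ : ℤ) ≠ 0 := Nat.cast_ne_zero.mpr (F.r₁_pos hK).ne'
  have hmcast : (((F.r₁ : ℤ) ^ 2 : ℤ) : 𝓞 K) = (F.m₁ : 𝓞 K) := by
    simp only [ClFieldCertS2.m₁, Nat.cast_pow, Int.cast_pow, Int.cast_natCast]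
  refine rank_le_of_checkSX r F hθ h3 h2 hpr c.cr hcore (extraNS c) ?_ ?_ hcount
  · -- `extraNS ∅`: the class vector of `∅` is `0 ∈` every local image
    simp only [extraNS, Bool.and_eq_true, List.all_eq_true, decide_eq_true_eq]
    exact ⟨fun n _ => by rw [uvecOdd_empty]; exact zero_mem_splitImgOdd _ _,
      fun n _ => by rw [uvecTwo_empty]; exact zero_mem_splitImgTwo _⟩
  · intro e W he hW hW0 hroot x y hxy hy U hsq
    have he' : (((F.r₁ : ℤ) ^ 2 : ℤ) : 𝓞 K) * e = lin hθ c.cr.Xt.1 c.cr.Xt.2.1 c.cr.Xt.2.2 := by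
      rw [hmcast]; exact he
    have hW' : ∀ j, (((F.r₁ : ℤ) ^ 2 : ℤ) : 𝓞 K) * W j = lin hθ ((famS c.cr).get j).X.1
        ((famS c.cr).get j).X.2.1 ((famS c.cr).get j).X.2.2 := fun j => by rw [hmcast]; exact hW j
    simp only [extraNS, Bool.and_eq_true, List.all_eq_true, decide_eq_true_eq]
    refine ⟨fun n hn => ?_, fun n hn => ?_⟩
    · -- an odd nodal prime
      have hcl := hnod n hn
      simp only [nodalClauseOddS, henselAll, Bool.and_eq_true, Bool.not_eq_true', decide_eq_false_iff_not,
        decide_eq_true_eq] at hcl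
      obtain ⟨⟨⟨⟨hℓ2, ⟨hh0, hh1⟩, hh2⟩, hdist⟩, hdepth⟩, hprec⟩ := hcl
      have hp : n.ℓ.Prime := List.forall_iff_forall_mem.mp hnp n.ℓ (List.mem_map.mpr ⟨n, hn, rfl⟩)
      haveI : Fact n.ℓ.Prime := ⟨hp⟩
      obtain ⟨R0⟩ := nonempty_rootedPrime_of_henselCheck (θ := θ) hirr hθ h3 hh0
      obtain ⟨R1⟩ := nonempty_rootedPrime_of_henselCheck (θ := θ) hirr hθ h3 hh1
      obtain ⟨R2⟩ := nonempty_rootedPrime_of_henselCheck (θ := θ) hirr hθ h3 hh2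
      have hφ : ∀ i : Fin 3, (![R0.φ, R1.φ, R2.φ] : Fin 3 → (K →+* ℚ_[n.ℓ])) i θ =
          ((![R0.z, R1.z, R2.z] : Fin 3 → ℤ_[n.ℓ]) i : ℚ_[n.ℓ]) := by
        intro i; fin_cases i
        exacts [R0.φ_theta, R1.φ_theta, R2.φ_theta]
      have hclose : ∀ i : Fin 3, ‖(![R0.z, R1.z, R2.z] : Fin 3 → ℤ_[n.ℓ]) i - (n.ar i : ℤ_[n.ℓ])‖ ≤
          (n.ℓ : ℝ) ^ (-(n.N : ℤ)) := by
        intro i; fin_cases i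
        exacts [R0.close, R1.close, R2.close]
      exact uvecOdd_mem_splitImgOdd (SqClassOdd.sqClassMapOdd n.ℓ) hℓ2 hθ hφ hclose hm he' hroot hW' hW0 hxy hy
        hsq hdist hdepth hprec
    · -- a `2`-adic nodal certificate
      have hcl := hnod2 n hn
      simp only [nodalClauseTwoS, henselAll, Bool.and_eq_true, decide_eq_true_eq] at hcl
      obtain ⟨⟨⟨⟨hℓ, ⟨hh0, hh1⟩, hh2⟩, hdist⟩, hdepth⟩, hprec⟩ := hcl
      rw [hℓ] at hh0 hh1 hh2
      obtain ⟨R0⟩ := nonempty_rootedPrime_of_henselCheck (θ := θ) hirr hθ h3 hh0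
      obtain ⟨R1⟩ := nonempty_rootedPrime_of_henselCheck (θ := θ) hirr hθ h3 hh1
      obtain ⟨R2⟩ := nonempty_rootedPrime_of_henselCheck (θ := θ) hirr hθ h3 hh2
      have hφ : ∀ i : Fin 3, (![R0.φ, R1.φ, R2.φ] : Fin 3 → (K →+* ℚ_[2])) i θ =
          ((![R0.z, R1.z, R2.z] : Fin 3 → ℤ_[2]) i : ℚ_[2]) := by
        intro i; fin_cases i
        exacts [R0.φ_theta, R1.φ_theta, R2.φ_theta]
      have hclose : ∀ i : Fin 3, ‖(![R0.z, R1.z, R2.z] : Fin 3 → ℤ_[2]) i - (n.ar i : ℤ_[2])‖ ≤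
          ((2 : ℕ) : ℝ) ^ (-(n.N : ℤ)) := by
        intro i; fin_cases i
        exacts [R0.close, R1.close, R2.close]
      exact uvecTwo_mem_splitImgTwo SqClassTwo.sqClassMapTwo hθ hφ hclose hm he' hroot hW' hW0 hxy hy hsq hdist
        hdepth hprec

/-- **`rank E(ℚ) = r`** (split-2 field record, complex case, nodal local conditions) from the checked records and
a tree lower bound. [cite: CremonaAlgorithms1997, §3.6] -/
theorem rank_eq_of_checkSN (r : ℕ) (F : ClFieldCertS2)
    (hθ : aeval θ (MonicCubic.poly F.fs.base.a F.fs.base.b F.fs.base.c) = 0) (h3 : finrank ℚ K = 3)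
    (h2 : F.check2 = true) (hpr : F.fs.base.primeList.Forall Nat.Prime)
    (c : ClCurveCertSN) (hnp : (c.nod.map NodalCert.ℓ).Forall Nat.Prime) (hc : checkSN F c r = true)
    (hlow : r ≤ (((⟨0, c.cr.A, 0, c.cr.B, c.cr.C⟩ : WeierstrassCurve ℤ)).map
      (Int.castRingHom ℚ)).mordellWeilRank) :
    (((⟨0, c.cr.A, 0, c.cr.B, c.cr.C⟩ : WeierstrassCurve ℤ)).map (Int.castRingHom ℚ)).mordellWeilRank =
      r := by
  have hV : ((⟨0, c.cr.A, 0, c.cr.B, c.cr.C⟩ : WeierstrassCurve ℤ)).map (Int.castRingHom ℚ) =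
      (⟨0, c.cr.A, 0, c.cr.B, c.cr.C⟩ : WeierstrassCurve ℚ) := by
    ext <;> simp [WeierstrassCurve.map]
  refine le_antisymm ?_ hlow
  rw [hV]
  exact rank_le_of_checkSN r F hθ h3 h2 hpr c hnp hc

end Sound

/-! ## `K`-free wrappers over the model `CubicField a b c` -/

section Rows

/-- **`rank E(ℚ) = r` from the records** (model `(0, A, 0, B, C)`, split-2 complex host, nodal local conditions).
[cite: Cassels1991LecturesEllipticCurves, §15] [cite: CremonaAlgorithms1997, §3.6] -/
theorem rank_eq_of_certsSN (r : ℕ) (F : ClFieldCertS2) (c : ClCurveCertSN) (h2 : F.check2 = true)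
    (hpr : F.fs.base.primeList.Forall Nat.Prime) (hnp : (c.nod.map NodalCert.ℓ).Forall Nat.Prime)
    (hc : checkSN F c r = true)
    (hlow : r ≤ (((⟨0, c.cr.A, 0, c.cr.B, c.cr.C⟩ : WeierstrassCurve ℤ)).map
      (Int.castRingHom ℚ)).mordellWeilRank) :
    (((⟨0, c.cr.A, 0, c.cr.B, c.cr.C⟩ : WeierstrassCurve ℤ)).map (Int.castRingHom ℚ)).mordellWeilRank =
      r := by
  haveI : Fact (Irreducible (MonicCubic.polyQ F.fs.base.a F.fs.base.b F.fs.base.c)) :=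
    ⟨F.fs.base.irreducible_of_field (F.field_of_check2 h2)⟩
  exact rank_eq_of_checkSN (K := CubicField F.fs.base.a F.fs.base.b F.fs.base.c) r F
    (CubicField.aeval_root _ _ _) (CubicField.finrank_eq _ _ _) h2 hpr c hnp hc hlow

/-- **`rank E(ℚ) = r` for the ORIGINAL model** `(a₁, a₂, a₃, a₄, a₆)` when the records certify its completed-square
model rescaled by `d ≠ 0`. [cite: CremonaAlgorithms1997, §3.6] [cite: SilvermanAEC2009, III.3.1(b)] -/
theorem rank_eq_of_certsSN_scaled (r : ℕ) (F : ClFieldCertS2) (c : ClCurveCertSN) (h2 : F.check2 = true)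
    (hpr : F.fs.base.primeList.Forall Nat.Prime) (hnp : (c.nod.map NodalCert.ℓ).Forall Nat.Prime)
    (hc : checkSN F c r = true) (a₁ a₂ a₃ a₄ a₆ d : ℤ) (hd : d ≠ 0)
    (hABC : c.cr.A = d ^ 2 * (a₁ ^ 2 + 4 * a₂) ∧ c.cr.B = d ^ 4 * (8 * (a₁ * a₃ + 2 * a₄)) ∧
      c.cr.C = d ^ 6 * (16 * (a₃ ^ 2 + 4 * a₆)))
    (hlow : r ≤ (((⟨a₁, a₂, a₃, a₄, a₆⟩ : WeierstrassCurve ℤ)).map (Int.castRingHom ℚ)).mordellWeilRank) :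
    (((⟨a₁, a₂, a₃, a₄, a₆⟩ : WeierstrassCurve ℤ)).map (Int.castRingHom ℚ)).mordellWeilRank = r := by
  obtain ⟨hA, hB, hC⟩ := hABC
  rw [mordellWeilRank_complSq_scaled a₁ a₂ a₃ a₄ a₆ d hd, ← hA, ← hB, ← hC] at hlow ⊢
  exact rank_eq_of_certsSN r F c h2 hpr hnp hc hlow

/-- The plain completed-square shape (`d = 1`). [cite: CremonaAlgorithms1997, §3.6] -/
theorem rank_eq_of_certsSN_complSq (r : ℕ) (F : ClFieldCertS2) (c : ClCurveCertSN) (h2 : F.check2 = true)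
    (hpr : F.fs.base.primeList.Forall Nat.Prime) (hnp : (c.nod.map NodalCert.ℓ).Forall Nat.Prime)
    (hc : checkSN F c r = true) (a₁ a₂ a₃ a₄ a₆ : ℤ)
    (hABC : c.cr.A = a₁ ^ 2 + 4 * a₂ ∧ c.cr.B = 8 * (a₁ * a₃ + 2 * a₄) ∧ c.cr.C = 16 * (a₃ ^ 2 + 4 * a₆))
    (hlow : r ≤ (((⟨a₁, a₂, a₃, a₄, a₆⟩ : WeierstrassCurve ℤ)).map (Int.castRingHom ℚ)).mordellWeilRank) :
    (((⟨a₁, a₂, a₃, a₄, a₆⟩ : WeierstrassCurve ℤ)).map (Int.castRingHom ℚ)).mordellWeilRank = r :=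
  rank_eq_of_certsSN_scaled r F c h2 hpr hnp hc a₁ a₂ a₃ a₄ a₆ 1 one_ne_zero
    (by obtain ⟨hA, hB, hC⟩ := hABC; exact ⟨by rw [hA]; ring, by rw [hB]; ring, by rw [hC]; ring⟩) hlow

/-- Row plumbing for a plain model `y² = x³ + a₂x² + a₄x + a₆`: the record's cubic IS the curve.
[cite: Cassels1991LecturesEllipticCurves, §15] -/
theorem rank_eq_of_certsSN_plain (r : ℕ) (F : ClFieldCertS2) (c : ClCurveCertSN) (h2 : F.check2 = true)
    (hpr : F.fs.base.primeList.Forall Nat.Prime) (hnp : (c.nod.map NodalCert.ℓ).Forall Nat.Prime)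
    (hc : checkSN F c r = true) (a₂ a₄ a₆ : ℤ) (hABC : c.cr.A = a₂ ∧ c.cr.B = a₄ ∧ c.cr.C = a₆)
    (hlow : r ≤ (((⟨0, a₂, 0, a₄, a₆⟩ : WeierstrassCurve ℤ)).map (Int.castRingHom ℚ)).mordellWeilRank) :
    (((⟨0, a₂, 0, a₄, a₆⟩ : WeierstrassCurve ℤ)).map (Int.castRingHom ℚ)).mordellWeilRank = r := by
  obtain ⟨rfl, rfl, rfl⟩ := hABC
  exact rank_eq_of_certsSN r F c h2 hpr hnp hc hlow

end Rows

end Summit.BirchSwinnertonDyer.BirchSwinnertonDyer.Rank2Observatory.TwoDescCl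

end
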